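import Summits.Ventures.WeilGRH.UniformConductorFloorPrincipalMod283Log12
import Summits.Ventures.WeilGRH.UniformConductorFloorPrincipalMod281Log12EvenA2
import Summits.Ventures.WeilGRH.UniformConductorFloorPrincipalMod281Log12EvenB2
import Summits.Ventures.WeilGRH.UniformConductorFloorPrincipalMod281Log12EvenC2
import Summits.Ventures.WeilGRH.UniformConductorFloorPrincipalMod281Log12EvenD2
import Summits.Ventures.WeilGRH.UniformConductorFloorPrincipalMod281Log12EvenE2
import Summits.Ventures.WeilGRH.UniformConductorFloorPrincipalMod281Log12EvenF2
import Summits.Ventures.WeilGRH.UniformConductorFloorPrincipalMod281Log12EvenG2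
import Summits.Ventures.WeilGRH.UniformConductorFloorPrincipalMod281Log12EvenH3
import Summits.Ventures.WeilGRH.UniformConductorFloorPrincipalMod281Log12EvenI3
import Summits.Ventures.WeilGRH.UniformConductorFloorPrincipalMod281Log12EvenJ3
import Summits.Ventures.WeilGRH.UniformConductorFloorPrincipalMod281Log12EvenK3
import Summits.Ventures.WeilGRH.UniformConductorFloorPrincipalMod281Log12EvenL3
import Summits.Ventures.WeilGRH.UniformConductorFloorPrincipalMod281Log12EvenM3
import Summits.Ventures.WeilGRH.UniformConductorFloorPrincipalMod281Log12EvenN3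
import Summits.Ventures.WeilGRH.UniformConductorFloorLog12Table256Valid
import Summits.Ventures.WeilGRH.TwistedDataRungAW
import Summits.Ventures.WeilGRH.TwistedGramEvenReal
import HarnessLib

/-!
# The PRINCIPAL character mod 281 at `a = (log 12)/2`: Weil positivity on `[−(log 12)/2, (log 12)/2]` (door E, character-weighted prime constant, the `S = 2^80` table
  `Log12Table`) — hence EVERY character mod 281 — THE LAST OPEN PRIME OF RUNG SIX (door primes `281`, `283`, `293`)

Cell `rh-explicit`, WEIL TRACK — GRH ARM (weil-grh-1 gen10; weil-grh-2 gen13's door-E pipeline at the `S = 2^80`, 256-MODE table `Log12Table.tab256`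
(`UniformConductorFloorLog12TableHi.lean`): with the 128-mode table the door is NOT positive definite for `χ₀` mod 281 (best even `λ_float = −0.0050` at
`14 × 127`; the far-block truncation loss ≈ `0.02` exceeds the margin `0.014` of `281` over the 32-mode Galerkin bottom `277.05`), with far block `B₃ = 255`
it is: even `λ = +0.00125` at `14 × 255`, `θ = 2/64` (`14 × 200` still fails).  At this width one even ROW exceeds the kernel memory guard, so the even rows
are checked by column HALVES (`TwistedGramCellCheckColsE.lean`) (width 2, ≈ 25–30 s each) in two or three files per row (35 files: the farm's kernel memory guard is cumulative over a file and the chunk cost grows with the row index) and re-glued; the mathematics and the door are unchanged).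
By `UniformFloor.WeilPositivityOnChar.of_principal` the all-characters statement `U_{(log 12)/2}(281)` is EQUIVALENT to the positivity of `χ₀ = 1` mod 281; the primes
`277` (razor, FALSE: `…PrincipalMod277Log12.lean`), `281`, `281`, `293` are left open at this rung by `UniformConductorFloorPrincipalLog12.lean` / `…JointFloorsLog12.lean`
(flat threshold `271.53`, uniform floor `296`; Galerkin bottoms of the coprime form `277.05` (32 modes) / `277.13` (48)).  Kernel-checked INSTANCE of weil-grh-5's door
`weilPositivityOnChar_of_twisted_formatC_dataAW` for `χ₀` mod 281: real, even, prime signs `ε = (1, 1, 1, 1, 1, 1, 1, 1)` on `2, 3, 4, 5, 7, 8, 9, 11`, `log q = log 281`;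
blocks `14 × 255 ∣ 16 × 40`, `θ = 2/64 ∣ 806/64`, kernel margins `λ = 0.00125 ∣ 2.1886`; the special-value table `Log12Table.tab` (`S = 2^80`, modes `< 256`: `Log12Table.tab256`, `tab256_valid`);
floors `[3, 2, 1, 1, 1, 1, 1, 1]` by the kernel interval test `TwistedEncl.checkFloors` via `TwistedEncl.mem_aopBoxW` (no `AopFloors` dependency at this window).  Data and kernel facts: `…PrincipalMod281Log12Data.lean`,
`…Even{A…N}{1,2,3}.lean`; this file: the typed door and the theorem.  RH/GRH-free; standard axioms.  References: H. Yoshida (1992) §§5–7 [Yoshida1992HermitianForms]; R. E. Moore (1966) Ch. 3 [Moore1966]; N. J. Higham (2002) [Higham2002ASNA].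
-/

noncomputable section

namespace Summit.Ventures.WeilGRH.PrincipalMod281Log12
open Literature.NumberTheory.LFunctions Literature.NumberTheory.LFunctions.Yoshida1992 Encl
open Literature.Analysis.ValidatedNumerics.NumericsMP Literature.Analysis.SpecialFunctions
open Summit.Ventures.WeilGRH.Log12Table
open Summit.Ventures.WeilGRH.TwistedEncl
open scoped Real ComplexConjugate ArithmeticFunction.vonMangoldt

/-- `log 281 ∈ LQ281`. [folklore] -/
theorem hLQ281 : MI.mem (2 ^ 80) (Real.log (281 : ℕ)) LQ281 := MI.mem_logNat (by positivity) tLQ281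
/-- `a(1+E(2a)) ∈ CC281`. [folklore] -/
theorem hCC281 : MI.mem (2 ^ 80) (a * (1 + weilArchDensity (2 * a))) CC281 := mem_ccBox (by positivity) consts_valid tCC281


/-- ★ The CHARACTER-WEIGHTED door `weilPositivityOnChar_of_twisted_formatC_dataAW` at `a = (log 12)/2` for modulus 281, specialised to this file's boxes and the
`S = 2^80` table `Log12Table.tab256` (valid below `128`): every remaining hypothesis is a kernel fact about the cell data or the character's reality and prime
signs. [cite: Yoshida1992HermitianForms, §7 pp. 305–312] -/
theorem rung281 (χ : DirichletCharacter ℂ 281) (hreal : ∀ n : ℕ, conj (χ (n : ZMod 281)) = χ (n : ZMod 281))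
    (hε : ∀ i < ks.length, (χ (((ks.getD i default).val : ℕ) : ZMod 281)).re = ((εs281.getD i 0 : ℤ) : ℝ))
    {dE : EvenCellData} {dO : OddCellData} (hNe : dE.B3 < 256) (hNo : dO.B3 + 1 < 256)
    (hCCe : dE.CC = CC281) (hAOPe : dE.AOP = AOP281) (hCCo : dO.CC = CC281) (hAOPo : dO.AOP = AOP281)
    (tSE : checkSignsE (2 ^ 80) C LQ281 tab256 dE = true) (tSO : checkSignsOA (2 ^ 80) 128 C LQ281 tab256 dO = true)
    {ρe δe ρo δo : ℤ} {DE LE DO LO : List (List ℤ)}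
    (tE : checkCellE (2 ^ 80) C εs281 LQ281 tab256 dE 60 ρe DE = true) (tPE : PsdDyadic.checkPsdMid dE.B δe ρe DE LE = true)
    (tO : checkCellO (2 ^ 80) C εs281 LQ281 tab256 dO 60 ρo DO = true) (tPO : PsdDyadic.checkPsdMid dO.B δo ρo DO LO = true) :
    WeilPositivityOnChar χ (Real.log 12 / 2) := by
    have hS : 0 < (2 : ℕ) ^ 80 := by positivity
    have hT : TabValid (2 ^ 80) a ks 256 tab256 := tab256_valid
    have hAOP : MI.mem (2 ^ 80) (∑ j ∈ weilPrimeIndex a, |(χ (j : ZMod 281)).re| * ((Λ j : ℝ) / Real.sqrt j *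
        (2 * Real.cos (π / (⌊2 * a / Real.log j⌋₊ + 2))))) AOP281 :=
      mem_aopBoxW hS a_pos primeData consts_valid χ hε PrincipalMod283Log12.tFL283 tAOP281
    have hCCe' : MI.mem (2 ^ 80) (a * (1 + weilArchDensity (2 * a))) dE.CC := by rw [hCCe]; exact hCC281
    have hCCo' : MI.mem (2 ^ 80) (a * (1 + weilArchDensity (2 * a))) dO.CC := by rw [hCCo]; exact hCC281
    have hAOPe' : MI.mem (2 ^ 80) (∑ j ∈ weilPrimeIndex a, |(χ (j : ZMod 281)).re| * ((Λ j : ℝ) / Real.sqrt j *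
        (2 * Real.cos (π / (⌊2 * a / Real.log j⌋₊ + 2))))) dE.AOP := by rw [hAOPe]; exact hAOP
    have hAOPo' : MI.mem (2 ^ 80) (∑ j ∈ weilPrimeIndex a, |(χ (j : ZMod 281)).re| * ((Λ j : ℝ) / Real.sqrt j *
        (2 * Real.cos (π / (⌊2 * a / Real.log j⌋₊ + 2))))) dO.AOP := by rw [hAOPo]; exact hAOP
    obtain ⟨hB2, hBB3, hθN, hθD, -, -, -⟩ := checkCellE_spec tE
    obtain ⟨hB1, hBB3o, hθNo, hθDo, -, -, -⟩ := checkCellO_spec tO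
    obtain ⟨h0e, hd0e, hwe⟩ := signsE_of_checkSignsE_A hS a_pos consts_valid hLQ281 hT (d := dE) hNe hCCe' hAOPe' tSE
    obtain ⟨h0o, hd0o, hwo⟩ := signsO_of_checkSignsOA_A hS a_pos consts_valid hLQ281 hT (d := dO) hNo hCCo' hAOPo' tSO
    have hSe := hSe_of_checkCellE hS a_pos primeData consts_valid χ hε hLQ281 hT (d := dE) (by omega) hCCe' tE tPE
    have hSo := hSo_of_checkCellO hS a_pos primeData consts_valid χ hε hLQ281 hT (d := dO) (by omega) hCCo' tO tPO
    have hθe : (0 : ℝ) < (dE.θN : ℝ) / dE.θD := by positivity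
    have hθo : (0 : ℝ) < (dO.θN : ℝ) / dO.θD := by positivity
    have h := weilPositivityOnChar_of_twisted_formatC_dataAW (q := 281) (by norm_num) χ hreal a_pos
      (Be := dE.B) (B3e := dE.B3) hB2 hBB3 (θe := (dE.θN : ℝ) / dE.θD)
      (d0e := (dE.d0N : ℝ) / 2 ^ dE.wbits) hθe (fun m ↦ (dE.wN.getD (m - dE.B) 0 : ℝ) / 2 ^ dE.wbits)
      h0e hd0e hwe hSe
      (Bo := dO.B) (B3o := dO.B3) hB1 hBB3o (θo := (dO.θN : ℝ) / dO.θD) (d0o := (dO.d0N : ℝ) / 2 ^ dO.wbits) hθo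
      (fun l ↦ (dO.wN.getD (l - dO.B) 0 : ℝ) / 2 ^ dO.wbits) h0o hd0o hwo hSo
    simpa only [a] using h

/-- the even cell: all `14` rows and the header — `checkCellE = true`. [folklore] -/
theorem tE281 : checkCellE (2 ^ 80) C εs281 LQ281 tab256 dE281 60 23 DE281 = true :=
  checkCellE_of_rows (by decide +kernel) (checkCellERows_glue (checkCellERows_glue (checkCellERows_glue (checkCellERows_glue (checkCellERows_glue (checkCellERows_glue (checkCellERows_glue (checkCellERows_glue (checkCellERows_glue (checkCellERows_glue (checkCellERows_glue (checkCellERows_glue (checkCellERows_glue tE281r0 tE281r1 rfl rfl) tE281r2 rfl rfl) tE281r3 rfl rfl) tE281r4 rfl rfl) tE281r5 rfl rfl) tE281r6 rfl rfl) tE281r7 rfl rfl) tE281r8 rfl rfl) tE281r9 rfl rfl) tE281r10 rfl rfl) tE281r11 rfl rfl) tE281r12 rfl rfl) tE281r13 rfl rfl) (le_refl _)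

/-- ★★★ **The PRINCIPAL character mod 281 is Weil-positive on `[−(log 12)/2, (log 12)/2]`** (`WeilPositivityOnChar (1 : DirichletCharacter ℂ 281) ((log 12)/2)`; door E with the
character-weighted constant on the `(log 12)/2` table; blocks `14 × 255 ∣ 16 × 40`, kernel margins `λ = 0.0013 ∣ 2.1886`).  With `UniformFloor.WeilPositivityOnChar.of_principal`
this is `U_{(log 12)/2}(281)` (assembled in `UniformConductorFloorLog12Primes.lean`). [cite: Yoshida1992HermitianForms, §7 pp. 305–312] -/
theorem weilPositivityOnChar_log12half_principal_mod_twoEightyOne : WeilPositivityOnChar (1 : DirichletCharacter ℂ 281) (Real.log 12 / 2) := by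
    have hreal : ∀ n : ℕ, conj ((1 : DirichletCharacter ℂ 281) (n : ZMod 281)) = (1 : DirichletCharacter ℂ 281) (n : ZMod 281) := by
      intro n
      by_cases hx : IsUnit ((n : ℕ) : ZMod 281)
      · rw [MulChar.one_apply hx, map_one]
      · rw [MulChar.map_nonunit _ hx, map_zero]
    have hε : ∀ i < ks.length, ((1 : DirichletCharacter ℂ 281) (((ks.getD i default).val : ℕ) : ZMod 281)).re = ((εs281.getD i 0 : ℤ) : ℝ) := by
      intro i hi
      have hi8 : i < 8 := by simpa [ks] using hi
      interval_cases i
      · show ((1 : DirichletCharacter ℂ 281) (((PrimeLen.val ⟨2, 1⟩ : ℕ)) : ZMod 281)).re = (((1 : ℤ)) : ℝ)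
        rw [show (PrimeLen.val ⟨2, 1⟩ : ℕ) = 2 from rfl,
          MulChar.one_apply (show IsUnit ((2 : ℕ) : ZMod 281) by rw [ZMod.isUnit_iff_coprime]; decide)]
        simp
      · show ((1 : DirichletCharacter ℂ 281) (((PrimeLen.val ⟨3, 1⟩ : ℕ)) : ZMod 281)).re = (((1 : ℤ)) : ℝ)
        rw [show (PrimeLen.val ⟨3, 1⟩ : ℕ) = 3 from rfl,
          MulChar.one_apply (show IsUnit ((3 : ℕ) : ZMod 281) by rw [ZMod.isUnit_iff_coprime]; decide)]
        simp
      · show ((1 : DirichletCharacter ℂ 281) (((PrimeLen.val ⟨2, 2⟩ : ℕ)) : ZMod 281)).re = (((1 : ℤ)) : ℝ)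
        rw [show (PrimeLen.val ⟨2, 2⟩ : ℕ) = 4 from rfl,
          MulChar.one_apply (show IsUnit ((4 : ℕ) : ZMod 281) by rw [ZMod.isUnit_iff_coprime]; decide)]
        simp
      · show ((1 : DirichletCharacter ℂ 281) (((PrimeLen.val ⟨5, 1⟩ : ℕ)) : ZMod 281)).re = (((1 : ℤ)) : ℝ)
        rw [show (PrimeLen.val ⟨5, 1⟩ : ℕ) = 5 from rfl,
          MulChar.one_apply (show IsUnit ((5 : ℕ) : ZMod 281) by rw [ZMod.isUnit_iff_coprime]; decide)]
        simp
      · show ((1 : DirichletCharacter ℂ 281) (((PrimeLen.val ⟨7, 1⟩ : ℕ)) : ZMod 281)).re = (((1 : ℤ)) : ℝ)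
        rw [show (PrimeLen.val ⟨7, 1⟩ : ℕ) = 7 from rfl,
          MulChar.one_apply (show IsUnit ((7 : ℕ) : ZMod 281) by rw [ZMod.isUnit_iff_coprime]; decide)]
        simp
      · show ((1 : DirichletCharacter ℂ 281) (((PrimeLen.val ⟨2, 3⟩ : ℕ)) : ZMod 281)).re = (((1 : ℤ)) : ℝ)
        rw [show (PrimeLen.val ⟨2, 3⟩ : ℕ) = 8 from rfl,
          MulChar.one_apply (show IsUnit ((8 : ℕ) : ZMod 281) by rw [ZMod.isUnit_iff_coprime]; decide)]
        simp
      · show ((1 : DirichletCharacter ℂ 281) (((PrimeLen.val ⟨3, 2⟩ : ℕ)) : ZMod 281)).re = (((1 : ℤ)) : ℝ)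
        rw [show (PrimeLen.val ⟨3, 2⟩ : ℕ) = 9 from rfl,
          MulChar.one_apply (show IsUnit ((9 : ℕ) : ZMod 281) by rw [ZMod.isUnit_iff_coprime]; decide)]
        simp
      · show ((1 : DirichletCharacter ℂ 281) (((PrimeLen.val ⟨11, 1⟩ : ℕ)) : ZMod 281)).re = (((1 : ℤ)) : ℝ)
        rw [show (PrimeLen.val ⟨11, 1⟩ : ℕ) = 11 from rfl,
          MulChar.one_apply (show IsUnit ((11 : ℕ) : ZMod 281) by rw [ZMod.isUnit_iff_coprime]; decide)]
        simp
    exact rung281 1 hreal hε (by decide) (by decide) rfl rfl rfl rfl tSE281 tSO281 tE281 tPE281 tO281 tPO281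

end Summit.Ventures.WeilGRH.PrincipalMod281Log12

end
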